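import Summits.ResolutionOfSingularities.ResolutionOfSingularities.Theorems.SectionAscentFibrewiseClosedPointsTraceIdealDimThree
import Summits.ResolutionOfSingularities.ResolutionOfSingularities.Theses.SectionAscent
import HarnessLib

/-!
# `FibrewiseClosedPoints` — the crux reduced to the two standard resolution conjectures (all
dimensions), sorry-free

Crux `stmt-ResolutionOfSingularities-15960`
(`Summit.ResolutionOfSingularities.ResolutionOfSingularities.Theses.SectionAscent.FibrewiseClosedPoints`,
route SectionAscent; kernel-equivalent to the route target `OneShotAffine` by
`Negative/LoadBearing.fibrewiseClosedPoints_iff_oneShotAffine`). This file is the COMPOSITION of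
the re-centering / trace-ideal-untwist mechanism landed by the line lead c2 (2026-08-17) in
`…TraceIdeal{,Colon,Blowup,Sequence,Assembly,DimThree}.lean`: it proves the crux BY NAME from two
hypotheses which are the standard conjectures of resolution of singularities, stated in the
tree's vocabulary and with NO reference to exact centres —

* (R) `hR` — **strong projective resolution of affine varieties, blow-up form**: every integral
  affine `Spec A` of finite type over a field has a non-zero ideal `J` with `Bl_J(Spec A)` regular
  and `Bl_J → Spec A` an isomorphism over `Reg(Spec A)` (Hironaka in characteristic `0`;
  Cossart–Piltant 2019 Thm 1.1 + Liu 8.1.24 in dimension `≤ 3`, Literature fact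
  `CossartPiltant2019AffineOneBlowup`; OPEN from dimension `4` in characteristic `p`). It is
  NECESSARY: the crux's conclusion gives it with `V(J) = Sing`.
* (P) `hP` — **principalization on regular schemes**: on every integral Noetherian regular
  excellent scheme every non-zero ideal sheaf becomes locally principal after a finite sequence of
  blowing ups along regular centres inside its non-principal loci (Hironaka / Kollár 2007
  Thm 3.21 in characteristic `0`; Cossart–Piltant 2019 Prop 4.3 in dimension `3`, tree fact
  `CossartPiltant2019Principalization`; OPEN beyond).

So `FibrewiseClosedPoints` — and with it the route target: strong ONE-SHOT resolution with centre
EXACTLY the singular locus — carries no difficulty beyond (R) ∧ (P): the "exact centre" clause,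
recorded on this crux as Cossart–Piltant's open question (arXiv:1412.0868 p. 3), is discharged by
the re-centering theorem `exists_oneShot_of_principalizationAt`. A line skeleton for this crux can
take `hR`, `hP` (or their level-wise forms) as its stubs and this theorem as its composition.

* `isNoetherian_affineBlowup`, `isExcellent_affineBlowup` — routine hypotheses of (P) for `Bl_J`.
* `exists_oneShot_of_principalizationAt` — the re-centering theorem with (P) as a bare local
  hypothesis on `Bl_J` (cf. `exists_oneShot_of_principalization`, which has CP's dimension-3 fact
  baked in).
* `fibrewiseClosedPoints_of_strongRes_of_principalization` — **(R) → (P) → FibrewiseClosedPoints**,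
  and its registered explicit form.

## Sources
* J. Kollár, J. Witaszek, arXiv:2102.03162, Thm 1 (normal case of the re-centering). [KollarWitaszek2021]
* V. Cossart, O. Piltant, J. Algebra 529 (2019), Thm 1.1, p. 3, Prop 4.3 (v1). [CossartPiltant2019]
* J. Kollár, *Lectures on Resolution of Singularities* (2007), Thm 3.21 (principalization). [Kollar2007]
* The Stacks Project, Tags 080A, 080B, 07QW. [StacksProject]
-/

noncomputable section

set_option linter.dupNamespace false

open AlgebraicGeometry CategoryTheory Literature.AlgebraicGeometry.Resolution

namespace Summit.ResolutionOfSingularities.ResolutionOfSingularities.Theorems.SectionAscent.TraceIdeal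

universe u

variable {A : Type u} [CommRing A]

/-! ## Reduction of the crux to the two standard conjectures (all dimensions) -/

/-- `Bl_J(Spec A)` is a Noetherian scheme for Noetherian `A` (proper over `Spec A`). [folklore] -/
theorem isNoetherian_affineBlowup [IsNoetherianRing A] (J : Ideal A) : IsNoetherian (affineBlowup J) := by
  haveI : IsLocallyNoetherian (affineBlowup J) := LocallyOfFiniteType.isLocallyNoetherian (affineBlowup.π J)
  haveI : CompactSpace (affineBlowup J) := QuasiCompact.compactSpace_of_compactSpace (affineBlowup.π J)
  exact {}

/-- `Bl_J(Spec A)` is excellent for `A` of finite type over a field (Stacks 07QW). [cite: StacksProject, Tag 07QW] -/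
theorem isExcellent_affineBlowup (K : Type u) {A : Type u} [Field K] [CommRing A] [Algebra K A]
    [Algebra.FiniteType K A] (J : Ideal A) : Scheme.IsExcellent (affineBlowup J) := by
  haveI : IsNoetherianRing A := Algebra.FiniteType.isNoetherianRing K A
  let g : Spec (.of A) ⟶ Spec (.of K) := Spec.map (CommRingCat.ofHom (algebraMap K A))
  haveI : LocallyOfFiniteType g :=
    (HasRingHomProperty.Spec_iff (P := @LocallyOfFiniteType)).mpr
      (RingHom.finiteType_algebraMap.mpr ‹Algebra.FiniteType K A›)
  exact Scheme.isExcellent_of_locallyOfFiniteType Stacks07QW_field_holds (affineBlowup.π J ≫ g)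

/-- **`OneShot` from a principalization of the untwisting centre — local hypothesis form**: as
`exists_oneShot_of_principalization`, with Cossart–Piltant's dimension-three fact replaced by the
bare hypothesis that non-zero ideal sheaves on `Bl_J(Spec A)` can be principalized by blowing up
regular centres in their non-principal loci (the shape of `CossartPiltant2019Principalization`,
Kollár 2007 Thm. 3.21 in general dimension — open in positive characteristic from dimension 4).
[cite: StacksProject, Tag 080B] -/
theorem exists_oneShot_of_principalizationAt [IsDomain A] [IsNoetherianRing A] (J : Ideal A) {a : A}
    (haJ : a ∈ J) (ha0 : a ≠ 0) (hreg : Scheme.IsRegular (affineBlowup J))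
    (hprin : ∀ 𝔭 : PrimeSpectrum A, IsRegularLocalRing (Localization.AtPrime 𝔭.asIdeal) →
      (J.map (algebraMap A (Localization.AtPrime 𝔭.asIdeal))).IsPrincipal)
    (hPJ : ∀ M : (affineBlowup J).IdealSheafData, M ≠ ⊥ →
      ∃ (S' : Scheme.{u}) (σ : S' ⟶ affineBlowup J),
        IsRegularCentreBlowupSeq σ M ∧ IsLocallyPrincipal (M.comap σ)) :
    ∃ I : Ideal A, I ≠ ⊥ ∧ Scheme.IsRegular (affineBlowup I) ∧
      ∀ 𝔭 : PrimeSpectrum A, I ≤ 𝔭.asIdeal ↔ ¬ IsRegularLocalRing (Localization.AtPrime 𝔭.asIdeal) := by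
  have hJ : J ≠ ⊥ := fun h => ha0 (by rw [h] at haJ; exact (Submodule.mem_bot A).mp haJ)
  haveI : IsIntegral (affineBlowup J) := affineBlowup.isIntegral hJ
  haveI : IsNoetherian (affineBlowup J) := isNoetherian_affineBlowup J
  set π := affineBlowup.π J
  set M := (Ideal.span {a}).colon (J : Set A)
  set Mt := affineBlowup.idealSheaf M
  have haM : a ∈ M := Submodule.mem_colon.mpr fun j _ => Ideal.mul_mem_right _ _
    (Ideal.mem_span_singleton_self a)
  have hM0 : M ≠ ⊥ := fun h => ha0 (by rw [h] at haM; exact (Submodule.mem_bot A).mp haM)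
  have hMt : Mt.comap π ≠ ⊥ := by
    refine (affineBlowup.isBlowup J).comap_ne_bot ?_ (affineBlowup.idealSheaf_ne_bot hM0)
    intro htop
    have hgen : (⟨⊥, Ideal.isPrime_bot⟩ : Spec (.of A)) ∈
        ((affineBlowup.idealSheaf J).support : Set (Spec (.of A))) := by
      rw [htop]; trivial
    rw [affineBlowup.support_idealSheaf] at hgen
    exact hJ (le_bot_iff.mp ((PrimeSpectrum.mem_zeroLocus _ _).mp hgen))
  obtain ⟨Y₁, σ, hseq, hlp⟩ := hPJ (Mt.comap π) hMt
  obtain ⟨𝔟, h𝔟, hsupp⟩ := IsRegularCentreBlowupSeq.exists_isBlowup_support_subset hseq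
  have hY : Scheme.IsRegular Y₁ := hseq.isRegular hreg
  obtain ⟨hint, hN, hne⟩ := hseq.isIntegral_and_comap_ne_bot inferInstance inferInstance hMt
  haveI := hint
  haveI := hN
  have hM : IsEffectiveCartier ((Mt.comap π).comap σ) := isEffectiveCartier_of_isLocallyPrincipal hne hlp
  have h𝔟_supp : (𝔟.support : Set (affineBlowup J)) ⊆
      π.base ⁻¹' {x : Spec (.of A) | ¬ IsRegularLocalRing (Localization.AtPrime x.asIdeal)} := by
    intro y hy hyreg
    exact hsupp hy (isLocallyPrincipalAt_comap_colon J haJ ha0 hprin y hyreg)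
  exact exists_oneShot_of_isBlowup J haJ ha0 hreg hprin σ 𝔟 h𝔟 h𝔟_supp hM hY

/-- **The crux `FibrewiseClosedPoints` from the two standard conjectures, all dimensions.** If
(R) every integral affine `Spec A` of finite type over a field has a non-zero `J` with `Bl_J`
regular and an isomorphism over `Reg` (strong projective resolution in blow-up form — Hironaka in
characteristic zero, Cossart–Piltant in dimension `≤ 3`, OPEN beyond), and (P) on every integral
Noetherian regular excellent scheme every non-zero ideal sheaf is principalized by blowing up
regular centres inside its non-principal locus (Hironaka / Kollár 2007 Thm. 3.21 in characteristic
zero, Cossart–Piltant Prop. 4.3 in dimension 3, OPEN beyond), then the crux holds: its conclusion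
`OneShot p (d+1)` is produced outright by the re-centering theorem (the hypotheses `OneShot p d`
and `Almost p (d+1)` are not used — cf. `Negative/LoadBearing`). [cite: KollarWitaszek2021, Thm. 1] -/
theorem fibrewiseClosedPoints_of_strongRes_of_principalization
    (hR : ∀ (K : Type) [Field K] (A : Type) [CommRing A] [IsDomain A] [Algebra K A]
      [Algebra.FiniteType K A], ∃ J : Ideal A, J ≠ ⊥ ∧ Scheme.IsRegular (affineBlowup J) ∧
        ∃ U : (Spec (.of A)).Opens,
          (U : Set (Spec (.of A))) = {x | IsRegularLocalRing (Localization.AtPrime x.asIdeal)} ∧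
          IsIso (affineBlowup.π J ∣_ U))
    (hP : ∀ (S : Scheme.{0}) [IsIntegral S] [IsNoetherian S], Scheme.IsRegular S →
      Scheme.IsExcellent S → ∀ M : S.IdealSheafData, M ≠ ⊥ →
        ∃ (S' : Scheme.{0}) (σ : S' ⟶ S), IsRegularCentreBlowupSeq σ M ∧ IsLocallyPrincipal (M.comap σ)) :
    Summit.ResolutionOfSingularities.ResolutionOfSingularities.Theses.SectionAscent.FibrewiseClosedPoints := by
  intro p _ d _ _ K _ _ A _ _ _ _ _
  haveI : IsNoetherianRing A := Algebra.FiniteType.isNoetherianRing K A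
  obtain ⟨J, hJ, hreg, U, hU, hiso⟩ := hR K A
  obtain ⟨a, haJ, ha0⟩ := J.ne_bot_iff.mp hJ
  haveI := hiso
  have hprin : ∀ 𝔭 : PrimeSpectrum A, IsRegularLocalRing (Localization.AtPrime 𝔭.asIdeal) →
      (J.map (algebraMap A (Localization.AtPrime 𝔭.asIdeal))).IsPrincipal := fun 𝔭 h𝔭 =>
    isPrincipal_map_of_isIso_morphismRestrict J U 𝔭 (by rw [← SetLike.mem_coe, hU]; exact h𝔭)
  haveI : IsIntegral (affineBlowup J) := affineBlowup.isIntegral hJ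
  haveI : IsNoetherian (affineBlowup J) := isNoetherian_affineBlowup J
  exact exists_oneShot_of_principalizationAt J haJ ha0 hreg hprin
    (hP (affineBlowup J) hreg (isExcellent_affineBlowup K J))


/-! ## Registered form -/

/-- Registered explicit form of `fibrewiseClosedPoints_of_strongRes_of_principalization`:
**the crux from (R) strong projective resolution in blow-up form and (P) principalization on regular
schemes.** [cite: KollarWitaszek2021, Thm. 1] -/
theorem fibrewiseClosedPoints_of_strongRes_of_principalization_explicit (hR : ∀ (K : Type) [Field K]
    (A : Type) [CommRing A] [IsDomain A] [Algebra K A]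
    [Algebra.FiniteType K A], ∃ J : Ideal A, J ≠ ⊥
      ∧ Literature.AlgebraicGeometry.Resolution.Scheme.IsRegular
    (Literature.AlgebraicGeometry.Resolution.affineBlowup J) ∧ ∃ U : (AlgebraicGeometry.Spec
    (CommRingCat.of A)).Opens, (U : Set (AlgebraicGeometry.Spec (CommRingCat.of A))) =
    {x | IsRegularLocalRing (Localization.AtPrime x.asIdeal)} ∧ CategoryTheory.IsIso
    (Literature.AlgebraicGeometry.Resolution.affineBlowup.π J ∣_ U)) (hP : ∀
    (S : AlgebraicGeometry.Scheme.{0}) [AlgebraicGeometry.IsIntegral S]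
    [AlgebraicGeometry.IsNoetherian S], Literature.AlgebraicGeometry.Resolution.Scheme.IsRegular S →
      Literature.AlgebraicGeometry.Resolution.Scheme.IsExcellent S → ∀ M : S.IdealSheafData, M ≠ ⊥ →
      ∃
    (S' : AlgebraicGeometry.Scheme.{0})
    (σ : S' ⟶ S), Literature.AlgebraicGeometry.Resolution.IsRegularCentreBlowupSeq σ M
      ∧ Literature.AlgebraicGeometry.Resolution.IsLocallyPrincipal
    (M.comap σ)) : Summit.ResolutionOfSingularities.ResolutionOfSingularities.Theses.SectionAscent.FibrewiseClosedPoints :=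
  fibrewiseClosedPoints_of_strongRes_of_principalization hR hP

end Summit.ResolutionOfSingularities.ResolutionOfSingularities.Theorems.SectionAscent.TraceIdeal

end
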